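import Mathlib
import HarnessLib
import Summits.Ventures.LatticeQCDFlow.Scoring.SectorLinearLaw

/-!
# The sector linear law ON THE WINDOWS PRACTITIONERS COMPUTE, and its typed instances: every exact
# sampler has `τ_W(1_A) ≥ W + ½ − Φ W(W+1)/(2a(1−a))` for every Γ-method window `W` — so `τ_W ≥ (W+1)/2`
# as long as `(W+1)Φ ≤ a(1−a)` — with `Φ ≤ 2π(S)` for a separating set `S` (theory-2) and
# `Φ ≤ π(A) q(Aᶜ)` for the flow sampler (mode collapse), reversible or not

HONEST FRAMING: exact (Metropolis-corrected) sampling algorithms for lattice gauge theory;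
figures of merit are autocorrelation/cost numbers at stated couplings and volumes; no
continuum-physics claim.

Venture `LatticeQCDFlow` (cell pub-lqcd), topic `Scoring`; FANOUT row 8 (`s0-cpn-nemc`, GEN-23).
NEW WORK of the cell, not a published result; no definition is introduced; nothing is cited as a
fact.  The row's `Scoring/SectorLinearLaw` (GEN-12) proved, for EVERY Markov kernel `κ` with `π`
invariant (no reversibility) and every measurable sector `A` (`a = π(A)`, exit flux
`Φ = (π ⊗ₘ κ)(A ×ˢ Aᶜ)`), the LINEAR LAW `C_{1_A − a}(t) ≥ a(1−a) − tΦ`, i.e.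
`ρ_t(1_A) ≥ 1 − tΦ/(a(1−a))`.  THIS FILE carries it to the objects a data analysis produces and to the
cell's typed flux bounds:
(1) with an EXTERNAL flux bound `(π ⊗ₘ κ)(A ×ˢ Aᶜ) ≤ T` (a tunnelling law): `C(t) ≥ a(1−a) − t·T`,
`ρ_t ≥ 1 − tT/(a(1−a))`;
(2) WINDOWS: an abstract bookkeeping lemma (`C(0) = V > 0`, `C(t) ≥ V − c t` for all `t` ⇒
`τ_W := ½ + Σ_{t=1}^{W} C(t)/C(0) ≥ W + ½ − cW(W+1)/(2V)`, `Scoring.tauIntWindow`) and its sector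
instances **`τ_W(1_A) ≥ W + ½ − Φ W(W+1)/(2a(1−a))`** and, while `(W+1)·Φ ≤ a(1−a)`,
**`τ_W(1_A) ≥ (W+1)/2`**: the windowed estimate grows linearly with the window up to `W ≈ a(1−a)/Φ`,
where it is `≈ a(1−a)/(2Φ)` — the bottleneck price (`Scoring/SectorBottleneckFloor`, reversible, infinite
window) recovered WITHOUT reversibility on finite windows;
(3) INSTANCES: in theory-2's typed setting (`Scaling/TunnellingLaws`: `S` separates the charge `Q` along
the a.s.-allowed move relation `R`, `π` invariant) the sector `{Q ∈ U}` has `Φ ≤ 2π(S)`, so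
`C(t) ≥ a(1−a) − 2tπ(S)` and `τ_W ≥ W + ½ − π(S)W(W+1)/(a(1−a))`; for the exact flow sampler
`indepMH q w` (target `π = w·q`; `Φ ≤ π(A) q(Aᶜ)`, `Scoring/SectorBottleneckFloor.indepMH_flux_le`)
**`ρ_t(1_A) ≥ 1 − t q(Aᶜ)/(1−a)`** and `τ_W ≥ W + ½ − q(Aᶜ)W(W+1)/(2(1−a))` — MODE COLLAPSE (`q(Aᶜ)`
small while `π(Aᶜ) = 1 − a` is not) FREEZES THE SECTOR AT EVERY LAG AND ON EVERY WINDOW, whatever the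
acceptance.  Companion for bounded observables instead of indicators: `Scoring/RareChangeAutocorrelation`.
Printed counterparts NAMED ONLY: conductance / bottleneck bounds (Lawler–Sokal 1988, Sinclair–Jerrum
1989); the Γ-method window (Madras–Sokal 1988, Wolff 2004).

## Content (`κ` Markov, `π` invariant probability law, `A` measurable, `a = π.real A`, `g = 1_A − a`,
## `Φ = ((π ⊗ₘ κ)(A ×ˢ Aᶜ)).toReal`)

* **`autocov_centredIndicator_ge_of_flux_le`**, `acf_centredIndicator_ge_of_flux_le` — (1);
* **`tauIntWindow_ge_of_linear_floor`** (abstract), **`tauIntWindow_centredIndicator_ge`**,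
  `tauIntWindow_centredIndicator_ge_of_flux_le`, **`tauIntWindow_centredIndicator_ge_half`** — (2);
* **`autocov_sector_ge_of_separating`**, `tauIntWindow_sector_ge_of_separating`,
  **`indepMH_acf_sector_ge`**, `indepMH_autocov_sector_ge`, `indepMH_tauIntWindow_sector_ge` — (3).

NOT CLAIMED: an infinite-window `τ_int` floor without reversibility (non-reversible tails can be
negative); the size of `Φ`, `π(S)` or `q(Aᶜ)` for any sampler of ours; any number.
-/

noncomputable section

namespace Summit.Ventures.LatticeQCDFlow.Scoring

open MeasureTheory ProbabilityTheory Filter Set Summit.Ventures.LatticeQCDFlow.Exactness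
open scoped ENNReal

variable {Ω : Type*} [MeasurableSpace Ω]

/-! ### §1 The linear law under an external flux bound -/

section External

variable {κ : Kernel Ω Ω} [IsMarkovKernel κ] {π : Measure Ω} [IsProbabilityMeasure π] {A : Set Ω}

/-- **`C_A(t) ≥ a(1−a) − t·T`** whenever `(π ⊗ₘ κ)(A ×ˢ Aᶜ) ≤ T < ∞` (`π` invariant; no reversibility). -/
theorem autocov_centredIndicator_ge_of_flux_le (hπ : Kernel.Invariant κ π) (hA : MeasurableSet A)
    {T : ℝ≥0∞} (hT : (π ⊗ₘ κ) (A ×ˢ Aᶜ) ≤ T) (hTtop : T ≠ ⊤) (t : ℕ) :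
    π.real A * (1 - π.real A) - t * T.toReal
      ≤ autocov κ π (fun x => A.indicator (1 : Ω → ℝ) x - π.real A) t := by
  have h := autocov_centredIndicator_ge_linear hπ hA t
  have hle : ((π ⊗ₘ κ) (A ×ˢ Aᶜ)).toReal ≤ T.toReal := ENNReal.toReal_mono hTtop hT
  have := mul_le_mul_of_nonneg_left hle (Nat.cast_nonneg t)
  linarith

/-- **`ρ_t(1_A) ≥ 1 − tT/(a(1−a))`** for `0 < a < 1` under the same external bound. -/
theorem acf_centredIndicator_ge_of_flux_le (hπ : Kernel.Invariant κ π) (hA : MeasurableSet A)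
    (ha0 : 0 < π.real A) (ha1 : π.real A < 1)
    {T : ℝ≥0∞} (hT : (π ⊗ₘ κ) (A ×ˢ Aᶜ) ≤ T) (hTtop : T ≠ ⊤) (t : ℕ) :
    1 - t * T.toReal / (π.real A * (1 - π.real A))
      ≤ autocov κ π (fun x => A.indicator (1 : Ω → ℝ) x - π.real A) t
          / autocov κ π (fun x => A.indicator (1 : Ω → ℝ) x - π.real A) 0 := by
  have hvar : 0 < π.real A * (1 - π.real A) := mul_pos ha0 (by linarith)
  rw [autocov_centredIndicator_zero hA, le_div_iff₀ hvar, sub_mul, one_mul,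
    div_mul_cancel₀ _ hvar.ne']
  exact autocov_centredIndicator_ge_of_flux_le hπ hA hT hTtop t

end External

/-! ### §2 Windows -/

section Window

/-- **ABSTRACT WINDOW BOOKKEEPING**: `C(0) = V > 0` and `V − c·t ≤ C(t)` for every `t` give
`W + ½ − c W(W+1)/(2V) ≤ tauIntWindow (fun t ↦ C t / C 0) W` for every `W`. -/
theorem tauIntWindow_ge_of_linear_floor {C : ℕ → ℝ} {V c : ℝ} (hV : 0 < V) (h0 : C 0 = V)
    (hC : ∀ t : ℕ, V - c * t ≤ C t) (W : ℕ) :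
    (W : ℝ) + 1 / 2 - c * (W * (W + 1)) / (2 * V) ≤ tauIntWindow (fun t => C t / C 0) W := by
  unfold tauIntWindow
  simp only [h0]
  have hterm : ∀ t ∈ Finset.range W, 1 - c * ((t : ℝ) + 1) / V ≤ C (t + 1) / V := by
    intro t _
    have h := hC (t + 1)
    push_cast at h
    have h' : (V - c * ((t : ℝ) + 1)) / V ≤ C (t + 1) / V := div_le_div_of_nonneg_right h hV.le
    rwa [sub_div, div_self hV.ne'] at h'
  have hsum := Finset.sum_le_sum hterm
  have hgauss : ∀ n : ℕ, ∑ t ∈ Finset.range n, ((t : ℝ) + 1) = (n : ℝ) * ((n : ℝ) + 1) / 2 := by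
    intro n
    induction n with
    | zero => simp
    | succ n ih => rw [Finset.sum_range_succ, ih]; push_cast; ring
  have hlhs : ∑ t ∈ Finset.range W, (1 - c * ((t : ℝ) + 1) / V)
      = (W : ℝ) - c * (W * (W + 1)) / (2 * V) := by
    rw [Finset.sum_sub_distrib, Finset.sum_const, Finset.card_range, nsmul_eq_mul, mul_one]
    have : ∑ t ∈ Finset.range W, c * ((t : ℝ) + 1) / V
        = c / V * ∑ t ∈ Finset.range W, ((t : ℝ) + 1) := by
      rw [Finset.mul_sum]
      exact Finset.sum_congr rfl fun t _ => by ring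
    rw [this, hgauss W]
    field_simp
  rw [hlhs] at hsum
  linarith

variable {κ : Kernel Ω Ω} [IsMarkovKernel κ] {π : Measure Ω} [IsProbabilityMeasure π] {A : Set Ω}

/-- **THE SECTOR WINDOW FLOOR WITHOUT REVERSIBILITY**: `0 < a < 1`, `π` invariant; for every `W`,
`W + ½ − Φ W(W+1)/(2a(1−a)) ≤ τ_W(1_A)` with `Φ = ((π ⊗ₘ κ)(A ×ˢ Aᶜ)).toReal`. -/
theorem tauIntWindow_centredIndicator_ge (hπ : Kernel.Invariant κ π) (hA : MeasurableSet A)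
    (ha0 : 0 < π.real A) (ha1 : π.real A < 1) (W : ℕ) :
    (W : ℝ) + 1 / 2 - ((π ⊗ₘ κ) (A ×ˢ Aᶜ)).toReal * (W * (W + 1)) / (2 * (π.real A * (1 - π.real A)))
      ≤ tauIntWindow (fun t => autocov κ π (fun x => A.indicator (1 : Ω → ℝ) x - π.real A) t
          / autocov κ π (fun x => A.indicator (1 : Ω → ℝ) x - π.real A) 0) W :=
  tauIntWindow_ge_of_linear_floor (mul_pos ha0 (by linarith)) (autocov_centredIndicator_zero hA)
    (fun t => by
      have h := autocov_centredIndicator_ge_linear hπ hA t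
      linarith) W

/-- The window floor under an external flux bound `(π ⊗ₘ κ)(A ×ˢ Aᶜ) ≤ T < ∞`:
`W + ½ − T W(W+1)/(2a(1−a)) ≤ τ_W(1_A)`. -/
theorem tauIntWindow_centredIndicator_ge_of_flux_le (hπ : Kernel.Invariant κ π)
    (hA : MeasurableSet A) (ha0 : 0 < π.real A) (ha1 : π.real A < 1)
    {T : ℝ≥0∞} (hT : (π ⊗ₘ κ) (A ×ˢ Aᶜ) ≤ T) (hTtop : T ≠ ⊤) (W : ℕ) :
    (W : ℝ) + 1 / 2 - T.toReal * (W * (W + 1)) / (2 * (π.real A * (1 - π.real A)))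
      ≤ tauIntWindow (fun t => autocov κ π (fun x => A.indicator (1 : Ω → ℝ) x - π.real A) t
          / autocov κ π (fun x => A.indicator (1 : Ω → ℝ) x - π.real A) 0) W :=
  tauIntWindow_ge_of_linear_floor (mul_pos ha0 (by linarith)) (autocov_centredIndicator_zero hA)
    (fun t => by
      have h := autocov_centredIndicator_ge_of_flux_le hπ hA hT hTtop t
      linarith) W

/-- **`τ_W(1_A) ≥ (W+1)/2` WHILE `(W+1)·Φ ≤ a(1−a)`**: up to the window `W ≈ a(1−a)/Φ` the windowed
autocorrelation time of a sector grows linearly with the window, for every exact sampler. -/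
theorem tauIntWindow_centredIndicator_ge_half (hπ : Kernel.Invariant κ π) (hA : MeasurableSet A)
    (ha0 : 0 < π.real A) (ha1 : π.real A < 1) {W : ℕ}
    (hW : ((W : ℝ) + 1) * ((π ⊗ₘ κ) (A ×ˢ Aᶜ)).toReal ≤ π.real A * (1 - π.real A)) :
    ((W : ℝ) + 1) / 2
      ≤ tauIntWindow (fun t => autocov κ π (fun x => A.indicator (1 : Ω → ℝ) x - π.real A) t
          / autocov κ π (fun x => A.indicator (1 : Ω → ℝ) x - π.real A) 0) W := by
  have h := tauIntWindow_centredIndicator_ge hπ hA ha0 ha1 W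
  have hvar : 0 < π.real A * (1 - π.real A) := mul_pos ha0 (by linarith)
  set Φ := ((π ⊗ₘ κ) (A ×ˢ Aᶜ)).toReal with hΦ
  -- `Φ W (W+1)/(2 a(1−a)) ≤ W/2`
  have hkey : Φ * (W * (W + 1)) / (2 * (π.real A * (1 - π.real A))) ≤ (W : ℝ) / 2 := by
    rw [div_le_iff₀ (mul_pos two_pos hvar)]
    have := mul_le_mul_of_nonneg_left hW (Nat.cast_nonneg W)
    linarith
  linarith

end Window

/-! ### §3 Instances: theory-2's separating sets; the flow sampler's mode collapse -/

section Separating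

variable {κ : Kernel Ω Ω} [IsMarkovKernel κ] {π : Measure Ω} [IsProbabilityMeasure π]
  {ι : Type*} {R : Ω → Ω → Prop} {Q : Ω → ι} {S : Set Ω} {U : Set ι}

/-- The typed flux bound: `S` separating `Q` along the a.s.-allowed relation `R`, `π` invariant ⇒ the
sector `{Q ∈ U}` has exit flux `≤ 2 π(S)`. -/
theorem sector_flux_le_of_separating (hS : ∀ ⦃x y⦄, R x y → Q x ≠ Q y → x ∈ S ∨ y ∈ S)
    (hπ : Kernel.Invariant κ π) (hR : ∀ᵐ q ∂(π ⊗ₘ κ), R q.1 q.2) (U : Set ι) :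
    (π ⊗ₘ κ) ((Q ⁻¹' U) ×ˢ (Q ⁻¹' U)ᶜ) ≤ 2 * π S := by
  have hsub : (Q ⁻¹' U) ×ˢ (Q ⁻¹' U)ᶜ ⊆ {p : Ω × Ω | Q p.1 ≠ Q p.2} := by
    rintro ⟨x, y⟩ ⟨hx, hy⟩ hq
    exact hy (by simpa [Set.mem_preimage, ← hq] using hx)
  exact (measure_mono hsub).trans
    (Theory2.Tunnelling.compProd_chargeChange_le_of_invariant hS π κ hπ hR)

/-- **TOPOLOGICAL FREEZING AT EVERY LAG, TYPED, NO REVERSIBILITY**: `C_{1_A}(t) ≥ a(1−a) − 2tπ(S)`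
for the sector `A = {Q ∈ U}`. -/
theorem autocov_sector_ge_of_separating (hS : ∀ ⦃x y⦄, R x y → Q x ≠ Q y → x ∈ S ∨ y ∈ S)
    (hπ : Kernel.Invariant κ π) (hR : ∀ᵐ q ∂(π ⊗ₘ κ), R q.1 q.2) (hA : MeasurableSet (Q ⁻¹' U))
    (t : ℕ) :
    π.real (Q ⁻¹' U) * (1 - π.real (Q ⁻¹' U)) - t * (2 * π.real S)
      ≤ autocov κ π (fun x => (Q ⁻¹' U).indicator (1 : Ω → ℝ) x - π.real (Q ⁻¹' U)) t := by
  have h := autocov_centredIndicator_ge_of_flux_le hπ hA (sector_flux_le_of_separating hS hπ hR U)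
    (ENNReal.mul_ne_top ENNReal.ofNat_ne_top (measure_ne_top π S)) t
  rwa [ENNReal.toReal_mul, ENNReal.toReal_ofNat, ← measureReal_def] at h

/-- **THE TYPED WINDOW FLOOR**: `τ_W(1_A) ≥ W + ½ − π(S)W(W+1)/(a(1−a))` for `A = {Q ∈ U}`,
`0 < a < 1`. -/
theorem tauIntWindow_sector_ge_of_separating (hS : ∀ ⦃x y⦄, R x y → Q x ≠ Q y → x ∈ S ∨ y ∈ S)
    (hπ : Kernel.Invariant κ π) (hR : ∀ᵐ q ∂(π ⊗ₘ κ), R q.1 q.2) (hA : MeasurableSet (Q ⁻¹' U))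
    (ha0 : 0 < π.real (Q ⁻¹' U)) (ha1 : π.real (Q ⁻¹' U) < 1) (W : ℕ) :
    (W : ℝ) + 1 / 2
        - 2 * π.real S * (W * (W + 1)) / (2 * (π.real (Q ⁻¹' U) * (1 - π.real (Q ⁻¹' U))))
      ≤ tauIntWindow (fun t =>
          autocov κ π (fun x => (Q ⁻¹' U).indicator (1 : Ω → ℝ) x - π.real (Q ⁻¹' U)) t
            / autocov κ π (fun x => (Q ⁻¹' U).indicator (1 : Ω → ℝ) x - π.real (Q ⁻¹' U)) 0) W := by
  have h := tauIntWindow_centredIndicator_ge_of_flux_le hπ hA ha0 ha1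
    (sector_flux_le_of_separating hS hπ hR U)
    (ENNReal.mul_ne_top ENNReal.ofNat_ne_top (measure_ne_top π S)) W
  rwa [ENNReal.toReal_mul, ENNReal.toReal_ofNat, ← measureReal_def] at h

end Separating

section ModeCollapse

variable {q : Measure Ω} [IsProbabilityMeasure q] {w : Ω → ℝ} {π : Measure Ω}
  [IsProbabilityMeasure π] {A : Set Ω}

/-- **MODE COLLAPSE FREEZES THE SECTOR AT EVERY LAG** (exact flow-MCMC kernel `indepMH q w`, target
`π = w·q`): `C_{1_A}(t) ≥ a(1−a) − t·a·q(Aᶜ)`. -/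
theorem indepMH_autocov_sector_ge (hw : Measurable w) (hw0 : ∀ x, 0 < w x)
    (hπ : (q.withDensity fun x => ENNReal.ofReal (w x)) = π) (hA : MeasurableSet A) (t : ℕ) :
    π.real A * (1 - π.real A) - t * (π.real A * q.real Aᶜ)
      ≤ autocov (indepMH q w) π (fun x => A.indicator (1 : Ω → ℝ) x - π.real A) t := by
  haveI : Fact (Measurable w) := ⟨hw⟩
  have hrev : Kernel.IsReversible (indepMH q w) π := by
    rw [← hπ]; exact indepMH_isReversible hw hw0
  have h := autocov_centredIndicator_ge_of_flux_le hrev.invariant hA (indepMH_flux_le hw hA)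
    (ENNReal.mul_ne_top (measure_ne_top π A) (measure_ne_top q Aᶜ)) t
  rwa [ENNReal.toReal_mul, ← measureReal_def, ← measureReal_def] at h

/-- **`ρ_t(1_A) ≥ 1 − t·q(Aᶜ)/(1 − a)`** for the flow sampler, `0 < a < 1`: a model that puts mass
`q(Aᶜ)` outside the sector keeps the sector indicator correlated for `≈ (1 − a)/q(Aᶜ)` steps. -/
theorem indepMH_acf_sector_ge (hw : Measurable w) (hw0 : ∀ x, 0 < w x)
    (hπ : (q.withDensity fun x => ENNReal.ofReal (w x)) = π) (hA : MeasurableSet A)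
    (ha0 : 0 < π.real A) (ha1 : π.real A < 1) (t : ℕ) :
    1 - t * q.real Aᶜ / (1 - π.real A)
      ≤ autocov (indepMH q w) π (fun x => A.indicator (1 : Ω → ℝ) x - π.real A) t
          / autocov (indepMH q w) π (fun x => A.indicator (1 : Ω → ℝ) x - π.real A) 0 := by
  have h1a : 0 < 1 - π.real A := by linarith
  have hvar : 0 < π.real A * (1 - π.real A) := mul_pos ha0 h1a
  rw [autocov_centredIndicator_zero hA, le_div_iff₀ hvar, sub_mul, one_mul]
  have h := indepMH_autocov_sector_ge hw hw0 hπ hA t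
  have e : (t : ℝ) * q.real Aᶜ / (1 - π.real A) * (π.real A * (1 - π.real A))
      = t * (π.real A * q.real Aᶜ) := by
    field_simp
  rw [e]
  exact h

/-- **THE FLOW SAMPLER'S WINDOW FLOOR**: `τ_W(1_A) ≥ W + ½ − q(Aᶜ) W(W+1)/(2(1−a))`. -/
theorem indepMH_tauIntWindow_sector_ge (hw : Measurable w) (hw0 : ∀ x, 0 < w x)
    (hπ : (q.withDensity fun x => ENNReal.ofReal (w x)) = π) (hA : MeasurableSet A)
    (ha0 : 0 < π.real A) (ha1 : π.real A < 1) (W : ℕ) :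
    (W : ℝ) + 1 / 2 - q.real Aᶜ * (W * (W + 1)) / (2 * (1 - π.real A))
      ≤ tauIntWindow (fun t => autocov (indepMH q w) π (fun x => A.indicator (1 : Ω → ℝ) x - π.real A) t
          / autocov (indepMH q w) π (fun x => A.indicator (1 : Ω → ℝ) x - π.real A) 0) W := by
  haveI : Fact (Measurable w) := ⟨hw⟩
  have hrev : Kernel.IsReversible (indepMH q w) π := by
    rw [← hπ]; exact indepMH_isReversible hw hw0
  have h := tauIntWindow_centredIndicator_ge_of_flux_le hrev.invariant hA ha0 ha1
    (indepMH_flux_le hw hA) (ENNReal.mul_ne_top (measure_ne_top π A) (measure_ne_top q Aᶜ)) W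
  rw [ENNReal.toReal_mul, ← measureReal_def, ← measureReal_def] at h
  have e : π.real A * q.real Aᶜ * ((W : ℝ) * (W + 1)) / (2 * (π.real A * (1 - π.real A)))
      = q.real Aᶜ * (W * (W + 1)) / (2 * (1 - π.real A)) := by
    have h1a : (1 - π.real A) ≠ 0 := by linarith
    field_simp
  linarith [e]

end ModeCollapse

end Summit.Ventures.LatticeQCDFlow.Scoring

end
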